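import Literature.Computability.QuantumComplexity.LowRankMatrixInversion
import HarnessLib

/-!
# Dequantized recommendation systems (CGLLTW, §4.1: Problem 4.1, Definition 4.2, Corollary 4.3)
# — the singular-value threshold `t`, `A_{σ,η} = A·t(AᵀA)`, and the error of the sketched
# low-rank approximation `A Rᵀ\bar t(CCᵀ)R`, on top of the tree's even SVT

Chia, Gilyén, Li, Lin, Tang, Wang, *Sampling-based sublinear low-rank matrix arithmetic framework
for dequantizing quantum machine learning*, J. ACM 69(5):33 (2022) = arXiv:1910.06151 (held text,
§4.1 "Recommendation systems", p. 23 L15 – p. 24 L45): "Tang's dequantization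
[tang2018QuantumInspiredRecommSys] of Kerenidis and Prakash's recommendation system
[kerenidis2016QRecSys] is the first dequantization in this line of work".

> **Problem 4.1.** For a matrix `A ∈ ℝ^{m×n}`, given `SQ(A)` and a row index `i ∈ [m]`, sample
> from `Â(i,·)` up to `δ` error in total variation distance, where `‖Â − A_{σ,η}‖_F ≤ ε‖A‖_F`.
>
> **Definition 4.2 (`A_{σ,η}`).** We define `A_{σ,η}` as a singular value transform of `A`
> satisfying `A_{σ,η} := P_{σ,η}^{(SV)}(A)`, `P_{σ,η}(λ) = λ` (`λ ≥ σ(1+η)`), `= 0` (`λ < σ(1−η)`),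
> `∈ [0, λ]` (otherwise). […] it suffices to find a good (smoothened) projector onto the top
> eigenvectors of `A†A`, so we can apply our even SVT result.
>
> **Corollary 4.3.** Suppose `0 < ε ≲ ‖A‖/‖A‖_F` and `η ≤ 0.99`.  A classical algorithm can
> solve (Problem 4.1) in time `Õ(K³κ⁵η⁻⁶ε⁻⁶ log³(1/δ) + K²κ(‖A(i,·)‖²/‖Â(i,·)‖²)η⁻²ε⁻² log²(1/δ))`.
>
> *Proof.* Note that `A_{σ,η} = A·t(A†A)`, where `t` is the thresholding function
> `t(x) = 0` (`x < (1−η)²σ²`), `= (x − (1−η)²σ²)/(4ησ²)` (`(1−η)²σ² ≤ x < (1+η)²σ²`),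
> `= 1` (`x ≥ (1+η)²σ²`).  We will apply (thm:evenSing) with error parameter `ε` to get matrices
> `R, C` such that `AR†\bar t(CC†)R` satisfies
> `‖A_{σ,1/6} − AR†\bar t(CC†)R‖_F ≤ ‖A‖_F‖t(A†A) − R†\bar t(CC†)R‖ ≤ ε‖A‖_F`.   (eqn:recs-svt)
> Since `t(x)` is `(4ησ²)⁻¹`-Lipschitz and `t(x)/x` is `(4η(1−η)²σ⁴)⁻¹`-Lipschitz, the sizes of
> `r` and `c` are […]. Next, we want to approximate `AR†` […by row-wise sparse sketches `A'`…].

What is formalized (real matrices, the tree's Frobenius-norm SQ toolbox):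

* **`t`** (`thr σ η = min(1, max(0, (x − (1−η)²σ²)/(4ησ²)))`, which IS the printed three-case
  function: `thr_of_le`, `thr_of_mem`, `thr_of_ge`, using `(1+η)² − (1−η)² = 4η`), `0 ≤ t ≤ 1`,
  `t(0) = 0`, **"`t(x)` is `(4ησ²)⁻¹`-Lipschitz"** PROVED (`abs_thr_sub_thr_le`); `\bar t = t(x)/x`
  with `x\bar t(x) = t(x)` and a PROVED Lipschitz constant `L/a + 1/a²` (`L = 1/(4ησ²)`,
  `a = (1−η)²σ²`; `abs_thrBar_sub_thrBar_le`, from `LowRankPCA.abs_div_sub_div_le`) — a valid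
  constant `≥` the printed (sharp) `(4η(1−η)²σ⁴)⁻¹`, which we do not re-derive;
* **`A_{σ,η} := A·t(AᵀA)`** (the proof's first line, taken as the definition; Definition 4.2
  allows any interpolation in the window) and **(eqn:recs-svt), pointwise in the sketch outcome**
  (`lowRank_sub_sketch_le`): for ANY `R` (`= SA`) and `C` (`= RT`),
  `‖A·t(AᵀA) − A·Rᵀ\bar t(CCᵀ)R‖_F ≤ ‖A‖_F·(L‖RᵀR − AᵀA‖_F + ‖R‖_F²·\bar L·‖RRᵀ − CCᵀ‖_F)` —
  `‖XY‖_F ≤ ‖X‖_F‖Y‖_F` (the Frobenius relaxation of the printed `‖A‖_F‖·‖`), the even-SVT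
  decomposition and Lemma 5.4 (through `LowRankInversion.evenSVT_on_good_event`);
* **Corollary 4.3, first half, in mass form** (`low_rank_recommendation`): with two-stage mass
  `> 1 − δ₁ − δ₂ − δ₃` (`LowRankPCA.two_sketch_good_event`), simultaneously for all `σ > 0` and
  `0 < η < 1`: `‖A·t(AᵀA) − A·Rᵀ\bar t(CCᵀ)R‖_F ≤ ‖A‖_F·(θ₁/(4ησ²) + φ‖A‖_F²·\bar L·θ₂)`.

Not formalized here: the second half of the proof (row-wise sparse approximations `A'(i,·)`,
(prop:appr-mms), (lem:evenSingBounds), the sampling step and its oversampling factor), Remark 4.4,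
and running times.  Real matrices; no named facts are introduced; everything stated is proved.

## References
* [ChiaEtAl2022] N.-H. Chia, A. Gilyén, T. Li, H.-H. Lin, E. Tang, C. Wang, J. ACM 69(5) (2022)
  33:1–33:72, doi:10.1145/3549524 (arXiv:1910.06151, held as `paper:arxiv-1910.06151`: §4.1,
  Problem 4.1, Definition 4.2, Corollary 4.3 and its proof, pp. 23–24 of the held text).
* [TangEwin2019] E. Tang, *A quantum-inspired classical algorithm for recommendation systems*,
  STOC 2019, 217–228, doi:10.1145/3313276.3316310 (arXiv:1807.04271) — the original
  dequantization ("[tang2018QuantumInspiredRecommSys]").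
* [KerenidisPrakash2017] I. Kerenidis, A. Prakash, *Quantum recommendation systems*, ITCS 2017
  (arXiv:1603.08675) — the quantum algorithm being dequantized.
-/

noncomputable section

open scoped Matrix

namespace Literature.Computability.QuantumComplexity

namespace SampleQuery

namespace LowRankRecommendation

open Finset LowRankPCA LowRankInversion

variable {m n s c : ℕ}

/-! ### The threshold `t` and `\bar t(x) = t(x)/x` -/

/-- CGLLTW's singular-value threshold on the squared singular values: `t(x) = 0` for
`x < (1−η)²σ²`, `t(x) = (x − (1−η)²σ²)/(4ησ²)` for `(1−η)²σ² ≤ x < (1+η)²σ²`, `t(x) = 1` for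
`x ≥ (1+η)²σ²` (written as a clamp of the ramp, the same function — see `thr_of_le`, `thr_of_mem`,
`thr_of_ge`). [cite: ChiaEtAl2022, §4.1 proof of Cor. 4.3 (the displayed three-case definition of
`t`)] -/
def thr (σ η x : ℝ) : ℝ := min 1 (max 0 ((x - (1 - η) ^ 2 * σ ^ 2) / (4 * η * σ ^ 2)))

/-- `\bar t(x) = t(x)/x` (with `0/0 = 0`). [cite: ChiaEtAl2022, §4.1 proof of Cor. 4.3
(`AR†\bar t(CC†)R`)] -/
def thrBar (σ η x : ℝ) : ℝ := thr σ η x / x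

section thr

variable {σ η : ℝ}

/-- "`t(x) = 0` for `x < (1−η)²σ²`" (indeed for `x ≤ (1−η)²σ²`). [cite: ChiaEtAl2022, §4.1 proof
of Cor. 4.3] -/
theorem thr_of_le (hσ : 0 < σ) (hη : 0 < η) {x : ℝ} (hx : x ≤ (1 - η) ^ 2 * σ ^ 2) :
    thr σ η x = 0 := by
  unfold thr
  rw [max_eq_left (div_nonpos_of_nonpos_of_nonneg (by linarith) (by positivity)),
    min_eq_right zero_le_one]

/-- "`t(x) = 1` for `x ≥ (1+η)²σ²`" (`(1+η)² − (1−η)² = 4η`). [cite: ChiaEtAl2022, §4.1 proof of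
Cor. 4.3] -/
theorem thr_of_ge (hσ : 0 < σ) (hη : 0 < η) {x : ℝ} (hx : (1 + η) ^ 2 * σ ^ 2 ≤ x) :
    thr σ η x = 1 := by
  unfold thr
  have hk : 0 < 4 * η * σ ^ 2 := by positivity
  have h1 : 1 ≤ (x - (1 - η) ^ 2 * σ ^ 2) / (4 * η * σ ^ 2) := by
    rw [le_div_iff₀ hk]; nlinarith
  rw [max_eq_right (zero_le_one.trans h1), min_eq_left h1]

/-- "`t(x) = (x − (1−η)²σ²)/(4ησ²)` for `(1−η)²σ² ≤ x < (1+η)²σ²`" (indeed `≤`). [cite: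
ChiaEtAl2022, §4.1 proof of Cor. 4.3] -/
theorem thr_of_mem (hσ : 0 < σ) (hη : 0 < η) {x : ℝ} (h1 : (1 - η) ^ 2 * σ ^ 2 ≤ x)
    (h2 : x ≤ (1 + η) ^ 2 * σ ^ 2) :
    thr σ η x = (x - (1 - η) ^ 2 * σ ^ 2) / (4 * η * σ ^ 2) := by
  unfold thr
  have hk : 0 < 4 * η * σ ^ 2 := by positivity
  rw [max_eq_right (div_nonneg (by linarith) hk.le), min_eq_right]
  rw [div_le_iff₀ hk]; nlinarith

/-- `0 ≤ t`. [cite: ChiaEtAl2022, Definition 4.2 (`P_{σ,η}(λ) ∈ [0, λ]`)] -/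
theorem thr_nonneg (σ η x : ℝ) : 0 ≤ thr σ η x := le_min zero_le_one (le_max_left _ _)

/-- `t ≤ 1`. [cite: ChiaEtAl2022, Definition 4.2] -/
theorem thr_le_one (σ η x : ℝ) : thr σ η x ≤ 1 := min_le_left _ _

/-- `|t| ≤ 1`. [cite: ChiaEtAl2022, Definition 4.2] -/
theorem abs_thr_le_one (σ η x : ℝ) : |thr σ η x| ≤ 1 := by
  rw [abs_of_nonneg (thr_nonneg σ η x)]; exact thr_le_one σ η x

/-- `t(0) = 0`. [cite: ChiaEtAl2022, §4.1 proof of Cor. 4.3] -/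
theorem thr_zero (hσ : 0 < σ) (hη : 0 < η) : thr σ η 0 = 0 := thr_of_le hσ hη (by positivity)

/-- **"`t(x)` is `(4ησ²)⁻¹`-Lipschitz."** [cite: ChiaEtAl2022, §4.1 proof of Cor. 4.3] -/
theorem abs_thr_sub_thr_le (hσ : 0 < σ) (hη : 0 < η) (x y : ℝ) :
    |thr σ η x - thr σ η y| ≤ (1 / (4 * η * σ ^ 2)) * |x - y| := by
  unfold thr
  have hk : 0 < 4 * η * σ ^ 2 := by positivity
  have h1 := abs_min_sub_min_le_max (1 : ℝ) (max 0 ((x - (1 - η) ^ 2 * σ ^ 2) / (4 * η * σ ^ 2)))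
    1 (max 0 ((y - (1 - η) ^ 2 * σ ^ 2) / (4 * η * σ ^ 2)))
  simp only [sub_self, abs_zero] at h1
  refine (h1.trans (max_le (abs_nonneg _) le_rfl)).trans ?_
  rw [max_comm (0 : ℝ) _, max_comm (0 : ℝ) _]
  refine (abs_max_sub_max_le_abs _ _ (0 : ℝ)).trans (le_of_eq ?_)
  rw [← sub_div, abs_div, abs_of_pos hk,
    show x - (1 - η) ^ 2 * σ ^ 2 - (y - (1 - η) ^ 2 * σ ^ 2) = x - y by ring]
  ring

/-- `x · \bar t(x) = t(x)` for every real `x`. [cite: ChiaEtAl2022, §4.1 proof of Cor. 4.3] -/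
theorem mul_thrBar (hσ : 0 < σ) (hη : 0 < η) (x : ℝ) : x * thrBar σ η x = thr σ η x := by
  unfold thrBar
  by_cases hx : x = 0
  · rw [hx, thr_zero hσ hη]; simp
  · exact mul_div_cancel₀ _ hx

/-- A Lipschitz constant for `\bar t`: `|\bar t(x) − \bar t(y)| ≤ (L/a + 1/a²)|x − y|` with
`L = 1/(4ησ²)`, `a = (1−η)²σ²` (`0 < η < 1`) — valid, and at least the printed sharp constant
`(4η(1−η)²σ⁴)⁻¹`. [cite: ChiaEtAl2022, §4.1 proof of Cor. 4.3 ("`t(x)/x` is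
`(4η(1−η)²σ⁴)⁻¹`-Lipschitz")] -/
theorem abs_thrBar_sub_thrBar_le (hσ : 0 < σ) (hη0 : 0 < η) (hη : η < 1) (x y : ℝ) :
    |thrBar σ η x - thrBar σ η y| ≤
      ((1 / (4 * η * σ ^ 2)) / ((1 - η) ^ 2 * σ ^ 2) + 1 / ((1 - η) ^ 2 * σ ^ 2) ^ 2) * |x - y| :=
  abs_div_sub_div_le (f := thr σ η)
    (by nlinarith [pow_pos hσ 2, mul_pos (sub_pos.2 hη) (sub_pos.2 hη)]) (by positivity)
    (fun z hz => thr_of_le hσ hη0 hz) (abs_thr_le_one σ η)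
    (abs_thr_sub_thr_le hσ hη0) x y

end thr

/-! ### `A_{σ,η} = A·t(AᵀA)` versus the sketched `A·Rᵀ\bar t(CCᵀ)R` -/

/-- `‖M − N‖_F = ‖N − M‖_F`. [folklore] (private plumbing) -/
private theorem frobSq_sub_comm' {k l : ℕ} (M N : Matrix (Fin k) (Fin l) ℝ) :
    frobSq (M - N) = frobSq (N - M) := by
  simp only [frobSq_eq_sum_sq, Matrix.sub_apply]
  exact Finset.sum_congr rfl fun i _ => Finset.sum_congr rfl fun j _ => by ring

/-- **(eqn:recs-svt), pointwise in the sketch outcome.**  For real `A` (`m×n`), any `R` (`s×n`,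
`= SA`) and `C` (`s×c`, `= RT`), `σ > 0`, `0 < η < 1`:
`‖A·t(AᵀA) − A·Rᵀ\bar t(CCᵀ)R‖_F`
`  ≤ ‖A‖_F·((1/(4ησ²))‖RᵀR − AᵀA‖_F + ‖R‖_F²(L/a + 1/a²)‖RRᵀ − CCᵀ‖_F)`
— "`‖A_{σ,η} − AR†\bar t(CC†)R‖_F ≤ ‖A‖_F‖t(A†A) − R†\bar t(CC†)R‖`" (here with the Frobenius
norm on the right, `≥` the printed operator norm) followed by the even-SVT decomposition and
Lemma 5.4 for `t` and `\bar t`. [cite: ChiaEtAl2022, §4.1 proof of Cor. 4.3, (eqn:recs-svt)] -/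
theorem lowRank_sub_sketch_le (A : Matrix (Fin m) (Fin n) ℝ) (R : Matrix (Fin s) (Fin n) ℝ)
    (C : Matrix (Fin s) (Fin c) ℝ) {σ η : ℝ} (hσ : 0 < σ) (hη0 : 0 < η) (hη : η < 1) :
    Real.sqrt (frobSq (A * cfc (thr σ η) (Aᵀ * A) - A * (Rᵀ * cfc (thrBar σ η) (C * Cᵀ) * R))) ≤
      Real.sqrt (frobSq A) *
        ((1 / (4 * η * σ ^ 2)) * Real.sqrt (frobSq (Rᵀ * R - Aᵀ * A)) +
          frobSq R * (((1 / (4 * η * σ ^ 2)) / ((1 - η) ^ 2 * σ ^ 2) +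
              1 / ((1 - η) ^ 2 * σ ^ 2) ^ 2) *
            Real.sqrt (frobSq (R * Rᵀ - C * Cᵀ)))) := by
  rw [← Matrix.mul_sub]
  refine (sqrt_frobSq_mul_le A _).trans (mul_le_mul_of_nonneg_left ?_ (Real.sqrt_nonneg _))
  have ha : 0 < (1 - η) ^ 2 * σ ^ 2 := by
    nlinarith [pow_pos hσ 2, mul_pos (sub_pos.2 hη) (sub_pos.2 hη)]
  rw [frobSq_sub_comm']
  have hdec := evenSVT_error_le R C A (thr σ η) (thrBar σ η) (fun x _ => mul_thrBar hσ hη0 x)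
  refine hdec.trans (add_le_add ?_ (mul_le_mul_of_nonneg_left ?_ (frobSq_nonneg R)))
  · exact frobNorm_cfc_gram_sub_le R A (thr σ η) (by positivity)
      (fun x y _ _ => abs_thr_sub_thr_le hσ hη0 x y)
  · have h := frobNorm_cfc_gram_sub_le Rᵀ Cᵀ (thrBar σ η)
      (L := (1 / (4 * η * σ ^ 2)) / ((1 - η) ^ 2 * σ ^ 2) + 1 / ((1 - η) ^ 2 * σ ^ 2) ^ 2)
      (add_nonneg (div_nonneg (by positivity) ha.le) (by positivity))
      (fun x y _ _ => abs_thrBar_sub_thrBar_le hσ hη0 hη x y)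
    simpa only [Matrix.transpose_transpose] using h

/-! ### Corollary 4.3, first half, in mass form -/

variable {φ : ℝ} {A : Matrix (Fin m) (Fin n) ℝ}

/-- Two-stage masses are monotone in the event (non-negative weights). [folklore] (private
plumbing, as in `LowRankPCA`) -/
private theorem twoStage_mass_mono'' {p : Fin m → ℝ} {q : (Fin s → Fin m) → Fin n → ℝ}
    (hp : ∀ k, 0 ≤ p k) (hq : ∀ ω k, 0 ≤ q ω k)
    {G P : (Fin s → Fin m) → (Fin c → Fin n) → Prop} [∀ ω, DecidablePred (G ω)]
    [∀ ω, DecidablePred (P ω)] (hGP : ∀ ω τ, G ω τ → P ω τ) :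
    ∑ ω : Fin s → Fin m, iidWeight p ω * ∑ τ ∈ univ.filter (G ω), iidWeight (q ω) τ ≤
      ∑ ω : Fin s → Fin m, iidWeight p ω * ∑ τ ∈ univ.filter (P ω), iidWeight (q ω) τ :=
  sum_le_sum fun ω _ => mul_le_mul_of_nonneg_left
    (sum_le_sum_of_subset_of_nonneg (fun τ hτ => by
        simp only [mem_filter, mem_univ, true_and] at hτ ⊢; exact hGP ω τ hτ)
      fun τ _ _ => iidWeight_nonneg (hq ω) τ)
    (iidWeight_nonneg hp ω)

open Classical in
/-- **Corollary 4.3 (recommendation systems / low-rank approximation from `SQ_φ(A)`; Frobenius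
form, explicit constants), first half of the printed proof in mass form.**  With `SQ_φ(A)`
(`A ≠ 0`), `s, c ≥ 1`, `δ₁, δ₂, δ₃ > 0`, `s ≥ 2φ² ln(1/δ₃)`, `θ₁ = √(8φ² log(2/δ₁)/s)‖A‖_F²`,
`θ₂ = φ√(32φ² log(2/δ₂)/c)‖A‖_F²`: with two-stage mass `> 1 − δ₁ − δ₂ − δ₃`, SIMULTANEOUSLY for
every `σ > 0` and `0 < η < 1`,
`‖A·t(AᵀA) − A·Rᵀ\bar t(CCᵀ)R‖_F ≤ ‖A‖_F·(θ₁/(4ησ²) + φ‖A‖_F²·(L/a + 1/a²)·θ₂)` (`L = 1/(4ησ²)`,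
`a = (1−η)²σ²`) — the printed "apply (thm:evenSing) with error parameter `ε` … ≤ ε‖A‖_F", the
target `ε` being read off from `s, c`. [cite: ChiaEtAl2022, §4.1 Cor. 4.3 and its proof
((eqn:recs-svt) and "the sizes of `r` and `c`")] -/
theorem low_rank_recommendation (W : MatrixOversamplingWitness φ A) (hA : A ≠ 0)
    (hs : 0 < s) (hc : 0 < c) {δ₁ δ₂ δ₃ : ℝ} (hδ₁ : 0 < δ₁) (hδ₂ : 0 < δ₂) (hδ₃ : 0 < δ₃)
    (hsδ : 2 * φ ^ 2 * Real.log (1 / δ₃) ≤ s) :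
    1 - δ₁ - δ₂ - δ₃ <
      ∑ ω : Fin s → Fin m, iidWeight (rowDist W.tilde) ω *
        ∑ τ ∈ univ.filter (fun τ : Fin c → Fin n =>
          ∀ (σ η : ℝ), 0 < σ → 0 < η → η < 1 →
            Real.sqrt (frobSq (A * cfc (thr σ η) (Aᵀ * A) -
              A * ((sketch (rowDist W.tilde) ω * A)ᵀ *
                cfc (thrBar σ η) ((sketch (rowDist (sketch (rowDist W.tilde) ω * W.tilde)ᵀ) τ *
                    (sketch (rowDist W.tilde) ω * A)ᵀ)ᵀ *
                  (sketch (rowDist (sketch (rowDist W.tilde) ω * W.tilde)ᵀ) τ *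
                    (sketch (rowDist W.tilde) ω * A)ᵀ)) *
                (sketch (rowDist W.tilde) ω * A)))) ≤
            Real.sqrt (frobSq A) *
              ((1 / (4 * η * σ ^ 2)) * (Real.sqrt (8 * φ ^ 2 * Real.log (2 / δ₁) / s) * frobSq A) +
                φ * frobSq A *
                  ((((1 / (4 * η * σ ^ 2)) / ((1 - η) ^ 2 * σ ^ 2) +
                      1 / ((1 - η) ^ 2 * σ ^ 2) ^ 2)) *
                    (φ * Real.sqrt (32 * φ ^ 2 * Real.log (2 / δ₂) / c) * frobSq A)))),
          iidWeight (rowDist (sketch (rowDist W.tilde) ω * W.tilde)ᵀ) τ := by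
  refine lt_of_lt_of_le (two_sketch_good_event W hA hs hc hδ₁ hδ₂ hδ₃ hsδ) ?_
  refine twoStage_mass_mono'' (W.isOversampledDist_rowDist hA).nonneg
    (fun ω k => div_nonneg (normSq_nonneg _) (frobSq_nonneg _)) fun ω τ hG => ?_
  intro σ η hσ hη0 hη
  have ha : 0 < (1 - η) ^ 2 * σ ^ 2 := by
    nlinarith [pow_pos hσ 2, mul_pos (sub_pos.2 hη) (sub_pos.2 hη)]
  have hLb : 0 ≤ (1 / (4 * η * σ ^ 2)) / ((1 - η) ^ 2 * σ ^ 2) + 1 / ((1 - η) ^ 2 * σ ^ 2) ^ 2 :=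
    add_nonneg (div_nonneg (by positivity) ha.le) (by positivity)
  rw [← Matrix.mul_sub]
  refine (sqrt_frobSq_mul_le A _).trans (mul_le_mul_of_nonneg_left ?_ (Real.sqrt_nonneg _))
  rw [frobSq_sub_comm']
  exact evenSVT_on_good_event A ω τ hG.1 hG.2.1 hG.2.2 (thr σ η) (thrBar σ η) (by positivity)
    (fun x y _ _ => abs_thr_sub_thr_le hσ hη0 x y) hLb
    (fun x y _ _ => abs_thrBar_sub_thrBar_le hσ hη0 hη x y) (fun x _ => mul_thrBar hσ hη0 x)

end LowRankRecommendation

end SampleQuery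

end Literature.Computability.QuantumComplexity
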